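import Mathlib
import HarnessLib
import Literature.AlgebraicGeometry.Ramification.InertiaNormalSylow
import Summits.ResolutionOfSingularities.ResolutionOfSingularities.Theorems.WildQuotientsWildQuotientResolutionTameEndState

/-!
# The boundary flag of Phase 0: p-closed TOP action ⟹ p-closed inertia; corank ≤ 1, vertex and toral corollaries
# (crux `WildQuotients.WildQuotientResolution`, stub `stub_phaseZeroHighDim`; any embedding dimension)

Crux stmt-ResolutionOfSingularities-15640 (`WildQuotientResolution`), registered stub `stub_phaseZeroHighDim`
(Phase 0 for `dim X′ ≥ 3`: a `G`-equivariant proper birational REGULAR model on which every inertia group is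
p-closed). ✓`TameEndState.hasNormalSylow_of_tame_trivial_mod_boundary` (p817841) is the END-STATE criterion of the
all-dimensional tame toroidalisation: boundary divisors `z₁, …, z_r` through the point, each stable to first order
under the inertia group `I`, and the elements of `I` of order prime to `p` acting TRIVIALLY on the residual
cotangent space `𝔪 / ((z) + 𝔪²)`. That last hypothesis is stronger than what equivariant blow-ups of tame centres
can reach: already for `SL₂(𝔽_p)` acting linearly on the plane (`p` odd), after the one blow-up of the origin that
makes every inertia group p-closed, at an `𝔽_p`-rational point `x` of the exceptional line `E = (u)` the inertia
group is a Borel subgroup `B`, its torus acts on the residual line `𝔪_x / ((u) + 𝔪_x²) = κ·w̄` through the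
character `a ↦ a⁻²` — non-trivially — and the fixed locus of `O_{p′}(B) = {±1}` is `E` itself, so no further
tame-centre blow-up changes `x`. What makes `B` p-closed is that the residual piece is a LINE. This file proves
the criterion in the generality the procedure needs — the action on the top piece factors through ANY p-closed
group — and reads off the three end states that occur:

**Theorem** (`hasNormalSylow_of_boundary_flag_kernel`, `hasNormalSylow_of_boundary_flag`). Let `(R, 𝔪, κ)` be a
Noetherian local ring of residue characteristic `p`, `τ : I →* (R ≃+* R)` a faithful residue-trivial action of
a finite group, `z : Fin r → 𝔪` with `τ g (zᵢ) ∈ (zᵢ) + 𝔪²` for all `g, i`. If the quotient of `I` by the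
kernel `M = {g | (τ g − 1) 𝔪 ⊆ (z) + 𝔪²}` of its action on the top piece `𝔪 / ((z) + 𝔪²)` has a normal Sylow
`p`-subgroup — equivalently, if some homomorphism `f : I → A` to a finite p-closed group has `ker f ≤ M` — then
`I` has a normal Sylow `p`-subgroup.

Corollaries: `hasNormalSylow_of_boundary_corank_le_one` — the top piece is spanned by ONE element `w`
(`𝔪 = (w) + (z) + 𝔪²`: the point lies on at least `edim − 1` stable boundary divisors; the `SL₂` example above);
`hasNormalSylow_of_stable_parameters` — the top piece vanishes (`𝔪 = (z) + 𝔪²`: a VERTEX of the boundary, the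
`zᵢ` containing a regular system of parameters); `hasNormalSylow_of_commutator_trivial_mod_boundary` — the
commutators of `I` act trivially on the top piece (the action there is through an ABELIAN group, e.g. a TORAL
action: simultaneously diagonal in some basis), the natural end state «the tame part acts torically modulo the
boundary»; and p817841 itself is the case `A = I / O^{p}`-type (top quotient a `p`-group).

Proof: the flag `𝔪² ⊆ (z₁) + 𝔪² ⊆ ⋯ ⊆ (z) + 𝔪² ⊆ 𝔪` of p817841 (line pieces with characters
✓`FlagCore.exists_character_of_line`, hence commutative piece quotients), the top piece now governed by the
hypothesis; ✓`FlagKernels.hasNormalSylow_of_stable_flag` concludes.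

[OURS · crux stmt-ResolutionOfSingularities-15640 · helper toward `stub_phaseZeroHighDim` (end-state criteria of
the all-dimensional tame layer; NOT a proof of the stub); folklore group theory / local algebra, counted 0;
AI-level work, weaker than expert review.] [folklore]

* `hasNormalSylow_quotient_of_ker_le` — `ker f ≤ M ⊴ I`, `f : I → A`, `A` finite p-closed ⟹ `I ⧸ M` p-closed;
* `hasNormalSylow_quotient_of_commutator_mem` — all commutators in `M` ⟹ `I ⧸ M` commutative, p-closed;
* `hasNormalSylow_of_boundary_flag_kernel`, `hasNormalSylow_of_boundary_flag` — the theorem (kernel / hom form);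
* `hasNormalSylow_of_boundary_corank_le_one`, `hasNormalSylow_of_stable_parameters`,
  `hasNormalSylow_of_commutator_trivial_mod_boundary` — the three end states.
-/

-- single-problem summit: the doubled namespace component `ResolutionOfSingularities` is forced
set_option linter.dupNamespace false

open IsLocalRing Literature.AlgebraicGeometry.Ramification
open Summit.ResolutionOfSingularities.ResolutionOfSingularities.Theorems.WildQuotientResolution.FlagCore
open Summit.ResolutionOfSingularities.ResolutionOfSingularities.Theorems.WildQuotientResolution.FlagKernels

namespace Summit.ResolutionOfSingularities.ResolutionOfSingularities.Theorems.WildQuotientResolution.TameEndState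

/-! ## Group theory of the top piece -/

section Group

variable {I : Type*} [Group I]

/-- If a normal subgroup `M` contains the kernel of a homomorphism `f : I → A` to a finite p-closed group,
then `I ⧸ M` is p-closed: it is a quotient of `I ⧸ ker f ≅ f(I) ≤ A`. [folklore] -/
theorem hasNormalSylow_quotient_of_ker_le {p : ℕ} [Fact p.Prime] [Finite I] {A : Type*} [Group A]
    [Finite A] (hA : HasNormalSylow p A) (f : I →* A) (M : Subgroup I) [M.Normal]
    (hM : ∀ g, f g = 1 → g ∈ M) : HasNormalSylow p (I ⧸ M) := by
  have hle : f.ker ≤ M := fun g hg => hM g hg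
  -- `f.range ≤ A` is p-closed, `I ⧸ ker f ≅ f.range`, and `I ⧸ M` is a quotient of `I ⧸ ker f`
  have h1 : HasNormalSylow p f.range := hA.subgroup f.range
  have h2 : HasNormalSylow p (I ⧸ f.ker) :=
    h1.of_surjective (QuotientGroup.quotientKerEquivRange f).symm.toMonoidHom
      (QuotientGroup.quotientKerEquivRange f).symm.surjective
  refine h2.of_surjective (QuotientGroup.map f.ker M (MonoidHom.id I) fun g hg => hle hg) ?_
  intro a
  obtain ⟨g, rfl⟩ := QuotientGroup.mk_surjective a
  exact ⟨QuotientGroup.mk g, rfl⟩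

/-- If a normal subgroup `M` contains every commutator `g h g⁻¹ h⁻¹`, then `I ⧸ M` is commutative, so each
of its Sylow `p`-subgroups is normal. [folklore] -/
theorem hasNormalSylow_quotient_of_commutator_mem {p : ℕ} (M : Subgroup I) [M.Normal]
    (hM : ∀ g h : I, g * h * g⁻¹ * h⁻¹ ∈ M) : HasNormalSylow p (I ⧸ M) := by
  have hcomm : ∀ a b : I ⧸ M, a * b = b * a := by
    intro a b
    obtain ⟨x, rfl⟩ := QuotientGroup.mk_surjective a
    obtain ⟨y, rfl⟩ := QuotientGroup.mk_surjective b
    rw [← QuotientGroup.mk_mul, ← QuotientGroup.mk_mul, QuotientGroup.eq]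
    have e : (x * y)⁻¹ * (y * x) = y⁻¹ * x⁻¹ * y⁻¹⁻¹ * x⁻¹⁻¹ := by group
    rw [e]
    exact hM _ _
  refine ⟨Classical.arbitrary _, ⟨fun n hn g => ?_⟩⟩
  rw [hcomm g n, mul_inv_cancel_right]
  exact hn

end Group

/-! ## The boundary flag with a p-closed top action -/

section LocalRing

variable {R : Type*} [CommRing R] [IsLocalRing R] {I : Type*} [Group I]

/-- **Boundary flag, kernel form** (crux stmt-ResolutionOfSingularities-15640, toward `stub_phaseZeroHighDim`;
any embedding dimension). Let `(R, 𝔪, κ)` be a Noetherian local ring of residue characteristic `p`, `τ` a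
faithful residue-trivial action of the finite group `I` on `R`, and `z : Fin r → 𝔪` local equations of
boundary divisors through the point, each `I`-stable to first order (`τ g (z i) ∈ (z i) + 𝔪²`). If for the
(some / every) normal subgroup `M` which is exactly the kernel of the action on the top piece
`𝔪 / ((z₁, …, z_r) + 𝔪²)` (`g ∈ M ↔ ∀ x ∈ 𝔪, τ g x − x ∈ (z) + 𝔪²`) the quotient `I ⧸ M` has a normal Sylow
`p`-subgroup, then so has `I`. (Flag `𝔪² ⊆ (z₁) + 𝔪² ⊆ ⋯ ⊆ (z) + 𝔪² ⊆ 𝔪`: line pieces carry characters,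
✓`FlagCore.exists_character_of_line`; ✓`FlagKernels.hasNormalSylow_of_stable_flag`.) [folklore] -/
theorem hasNormalSylow_of_boundary_flag_kernel (p : ℕ) [Fact p.Prime] [IsNoetherianRing R]
    [CharP (ResidueField R) p] [Finite I] {τ : I →* (R ≃+* R)} (hτ : Function.Injective τ)
    (hres : ∀ (g : I) (r : R), τ g r - r ∈ maximalIdeal R)
    {r : ℕ} (z : Fin r → R) (hz : ∀ i, z i ∈ maximalIdeal R)
    (hstab : ∀ (g : I) (i : Fin r), τ g (z i) ∈ Ideal.span {z i} ⊔ maximalIdeal R ^ 2)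
    (htop : ∀ (M : Subgroup I) [M.Normal],
      (∀ g, g ∈ M ↔ ∀ x ∈ maximalIdeal R,
        τ g x - x ∈ Ideal.span (Set.range z) ⊔ maximalIdeal R ^ 2) → HasNormalSylow p (I ⧸ M)) :
    HasNormalSylow p I := by
  classical
  set m := maximalIdeal R with hmdef
  -- the partial boundary sets and the flag
  let S : ℕ → Set R := fun i => {x | ∃ j : Fin r, (j : ℕ) < i ∧ z j = x}
  let K : ℕ → Ideal R := fun i => if i ≤ r then Ideal.span (S i) ⊔ m ^ 2 else m
  have hK_le : ∀ {i}, i ≤ r → K i = Ideal.span (S i) ⊔ m ^ 2 := fun {i} hi => if_pos hi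
  have hK_gt : ∀ {i}, ¬ i ≤ r → K i = m := fun {i} hi => if_neg hi
  have hSm : ∀ i, S i ⊆ m := by
    rintro i _ ⟨j, -, rfl⟩
    exact hz j
  have hm2 : m ^ 2 ≤ m := Ideal.pow_le_self two_ne_zero
  have hKm : ∀ i, K i ≤ m := by
    intro i
    by_cases hi : i ≤ r
    · rw [hK_le hi]
      exact sup_le (Ideal.span_le.mpr (hSm i)) hm2
    · rw [hK_gt hi]
  have hK2 : ∀ i, m ^ 2 ≤ K i := by
    intro i
    by_cases hi : i ≤ r
    · rw [hK_le hi]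
      exact le_sup_right
    · rw [hK_gt hi]
      exact hm2
  have hK0 : K 0 ≤ m ^ 2 := by
    rw [hK_le (Nat.zero_le r)]
    refine sup_le (Ideal.span_le.mpr ?_) le_rfl
    rintro _ ⟨j, hj, -⟩
    exact absurd hj (Nat.not_lt_zero _)
  have hKn : m ≤ K (r + 1) := by
    rw [hK_gt (by omega)]
  -- `τ`-stability of the flag
  have hspanτ : ∀ (g : I) (i : ℕ), i ≤ r → ∀ x ∈ Ideal.span (S i), τ g x ∈ K i := by
    intro g i hi x hx
    rw [hK_le hi]
    induction hx using Submodule.span_induction with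
    | mem y hy =>
      obtain ⟨j, hj, rfl⟩ := hy
      have hle : Ideal.span {z j} ⊔ m ^ 2 ≤ Ideal.span (S i) ⊔ m ^ 2 :=
        sup_le_sup_right (Ideal.span_mono (Set.singleton_subset_iff.mpr
          (show z j ∈ S i from ⟨j, hj, rfl⟩))) _
      exact hle (hstab g j)
    | zero => rw [map_zero]; exact zero_mem _
    | add x y _ _ hx hy => rw [map_add]; exact add_mem hx hy
    | smul a x _ hx => rw [smul_eq_mul, map_mul]; exact Ideal.mul_mem_left _ _ hx
  have hKτ : ∀ (g : I) (i : ℕ), ∀ x ∈ K i, τ g x ∈ K i := by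
    intro g i x hx
    by_cases hi : i ≤ r
    · rw [hK_le hi] at hx
      obtain ⟨a, ha, b, hb, rfl⟩ := Submodule.mem_sup.mp hx
      rw [map_add]
      refine add_mem (hspanτ g i hi a ha) ?_
      exact hK2 i (apply_mem_sq_of_res τ g hb)
    · rw [hK_gt hi] at hx ⊢
      exact apply_mem_maximalIdeal_of_res hres g hx
  -- the line pieces: `K (i+1) = (z i) + K i` for `i < r`
  have hline : ∀ (i : ℕ) (hi : i < r), ∀ x ∈ K (i + 1), ∃ a : R, x - a * z ⟨i, hi⟩ ∈ K i := by
    intro i hi x hx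
    rw [hK_le (by omega : i + 1 ≤ r)] at hx
    obtain ⟨a', ha', b, hb, rfl⟩ := Submodule.mem_sup.mp hx
    have hS : S (i + 1) ⊆ insert (z ⟨i, hi⟩) (S i) := by
      rintro _ ⟨j, hj, rfl⟩
      by_cases hji : (j : ℕ) < i
      · exact Set.mem_insert_of_mem _ ⟨j, hji, rfl⟩
      · have hje : j = ⟨i, hi⟩ := Fin.ext (by simp only; omega)
        rw [hje]
        exact Set.mem_insert _ _
    have ha'' : a' ∈ Ideal.span (insert (z ⟨i, hi⟩) (S i)) := Ideal.span_mono hS ha'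
    rw [Ideal.span_insert] at ha''
    obtain ⟨c, hc, d, hd, rfl⟩ := Submodule.mem_sup.mp ha''
    obtain ⟨a, rfl⟩ := Ideal.mem_span_singleton'.mp hc
    refine ⟨a, ?_⟩
    have e : a * z ⟨i, hi⟩ + d + b - a * z ⟨i, hi⟩ = d + b := by ring
    rw [e, hK_le (by omega : i ≤ r)]
    exact add_mem (Ideal.mem_sup_left hd) (Ideal.mem_sup_right hb)
  -- the top piece: `K r = (z) + 𝔪²`
  have hKr : K r = Ideal.span (Set.range z) ⊔ m ^ 2 := by
    rw [hK_le le_rfl]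
    congr 2
    ext x
    constructor
    · rintro ⟨j, -, rfl⟩
      exact ⟨j, rfl⟩
    · rintro ⟨j, rfl⟩
      exact ⟨j, j.isLt, rfl⟩
  -- assemble
  refine hasNormalSylow_of_stable_flag p hτ hres (r + 1) K hK0 hKn hKτ fun i hi M _ hM => ?_
  by_cases hir : i < r
  · -- line piece: character of the line `K (i+1) / K i`
    have hzi : z ⟨i, hir⟩ ∈ (K (i + 1) : Set R) := by
      show z ⟨i, hir⟩ ∈ K (i + 1)
      rw [hK_le (by omega : i + 1 ≤ r)]
      exact Ideal.mem_sup_left (Ideal.subset_span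
        (show z ⟨i, hir⟩ ∈ S (i + 1) from ⟨⟨i, hir⟩, Nat.lt_succ_self i, rfl⟩))
    obtain ⟨ν, hν⟩ := exists_character_of_line τ hres (L := (K (i + 1) : Set R))
      (fun x hx => hKm _ hx) (fun g x hx => hKτ g _ x hx) (K i) (fun g x hx => hKτ g i x hx)
      (hK2 i) hzi (hline i hir)
    exact hasNormalSylow_quotient_of_comm_character ν M fun g hg => (hM g).mpr (hν g hg)
  · -- top piece `i = r`
    have hieq : i = r := by omega
    subst hieq
    refine htop M fun g => ?_
    rw [hM g, hKr, hK_gt (by omega)]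

/-- **Boundary flag, homomorphism form**: as `hasNormalSylow_of_boundary_flag_kernel`, the top hypothesis being
that some homomorphism `f : I → A` to a finite p-closed group `A` has its kernel acting trivially on the top
piece `𝔪 / ((z) + 𝔪²)` (`f g = 1 ⟹ τ g x − x ∈ (z) + 𝔪²` for `x ∈ 𝔪`). p817841 is the case in which the top
quotient is a `p`-group; `A` abelian is the toral end state. [folklore] -/
theorem hasNormalSylow_of_boundary_flag (p : ℕ) [Fact p.Prime] [IsNoetherianRing R]
    [CharP (ResidueField R) p] [Finite I] {τ : I →* (R ≃+* R)} (hτ : Function.Injective τ)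
    (hres : ∀ (g : I) (r : R), τ g r - r ∈ maximalIdeal R)
    {r : ℕ} (z : Fin r → R) (hz : ∀ i, z i ∈ maximalIdeal R)
    (hstab : ∀ (g : I) (i : Fin r), τ g (z i) ∈ Ideal.span {z i} ⊔ maximalIdeal R ^ 2)
    {A : Type*} [Group A] [Finite A] (hA : HasNormalSylow p A) (f : I →* A)
    (hker : ∀ g : I, f g = 1 → ∀ x ∈ maximalIdeal R,
      τ g x - x ∈ Ideal.span (Set.range z) ⊔ maximalIdeal R ^ 2) :
    HasNormalSylow p I :=
  hasNormalSylow_of_boundary_flag_kernel p hτ hres z hz hstab fun M _ hM =>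
    hasNormalSylow_quotient_of_ker_le hA f M fun g hg => (hM g).mpr (hker g hg)

/-! ## The three end states -/

/-- **Corank ≤ 1**: if, besides the first-order-stable boundary equations `z₁, …, z_r`, ONE further element
`w ∈ 𝔪` spans the cotangent space (`every x ∈ 𝔪` is `a·w` modulo `(z) + 𝔪²`) — the point lies on at least
`edim R − 1` `I`-stable boundary divisors — then `I` is p-closed: the top piece is a line, on which `I` acts
through a character (✓`FlagCore.exists_character_of_line`). This is the case of the `𝔽_p`-points of the
exceptional line for `SL₂(𝔽_p)` on the plane (inertia a Borel subgroup). [folklore] -/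
theorem hasNormalSylow_of_boundary_corank_le_one (p : ℕ) [Fact p.Prime] [IsNoetherianRing R]
    [CharP (ResidueField R) p] [Finite I] {τ : I →* (R ≃+* R)} (hτ : Function.Injective τ)
    (hres : ∀ (g : I) (r : R), τ g r - r ∈ maximalIdeal R)
    {r : ℕ} (z : Fin r → R) (hz : ∀ i, z i ∈ maximalIdeal R)
    (hstab : ∀ (g : I) (i : Fin r), τ g (z i) ∈ Ideal.span {z i} ⊔ maximalIdeal R ^ 2)
    {w : R} (hw : w ∈ maximalIdeal R)
    (hgen : ∀ x ∈ maximalIdeal R, ∃ a : R, x - a * w ∈ Ideal.span (Set.range z) ⊔ maximalIdeal R ^ 2) :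
    HasNormalSylow p I := by
  set K : Ideal R := Ideal.span (Set.range z) ⊔ maximalIdeal R ^ 2 with hKdef
  have hK2 : maximalIdeal R ^ 2 ≤ K := le_sup_right
  -- `K` is `τ`-stable
  have hspanτ : ∀ (g : I), ∀ x ∈ Ideal.span (Set.range z), τ g x ∈ K := by
    intro g x hx
    induction hx using Submodule.span_induction with
    | mem y hy =>
      obtain ⟨j, rfl⟩ := hy
      have hle : Ideal.span {z j} ⊔ maximalIdeal R ^ 2 ≤ K :=
        sup_le_sup_right (Ideal.span_mono (Set.singleton_subset_iff.mpr (Set.mem_range_self j))) _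
      exact hle (hstab g j)
    | zero => rw [map_zero]; exact zero_mem _
    | add x y _ _ hx hy => rw [map_add]; exact add_mem hx hy
    | smul a x _ hx => rw [smul_eq_mul, map_mul]; exact Ideal.mul_mem_left _ _ hx
  have hKτ : ∀ (g : I), ∀ x ∈ K, τ g x ∈ K := by
    intro g x hx
    obtain ⟨a, ha, b, hb, rfl⟩ := Submodule.mem_sup.mp hx
    rw [map_add]
    exact add_mem (hspanτ g a ha) (hK2 (apply_mem_sq_of_res τ g hb))
  obtain ⟨ν, hν⟩ := exists_character_of_line τ hres (L := (maximalIdeal R : Set R))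
    (fun x hx => hx) (fun g x hx => apply_mem_maximalIdeal_of_res hres g hx) K hKτ hK2 hw hgen
  haveI : Finite ν.range := Finite.of_surjective ν.rangeRestrict ν.rangeRestrict_surjective
  have hA : HasNormalSylow p ν.range := ⟨Classical.arbitrary _, inferInstance⟩
  refine hasNormalSylow_of_boundary_flag p hτ hres z hz hstab hA ν.rangeRestrict fun g hg x hx => ?_
  have hg1 : ν g = 1 := by
    have := congrArg Subtype.val hg
    simpa using this
  exact hν g hg1 x hx

/-- **Vertex**: if the first-order-stable boundary equations `z₁, …, z_r` already span the cotangent space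
(`𝔪 ⊆ (z) + 𝔪²`: the point is a vertex of the boundary, the `zᵢ` contain a regular system of parameters),
then `I` is p-closed — every piece of the flag is a line. [folklore] -/
theorem hasNormalSylow_of_stable_parameters (p : ℕ) [Fact p.Prime] [IsNoetherianRing R]
    [CharP (ResidueField R) p] [Finite I] {τ : I →* (R ≃+* R)} (hτ : Function.Injective τ)
    (hres : ∀ (g : I) (r : R), τ g r - r ∈ maximalIdeal R)
    {r : ℕ} (z : Fin r → R) (hz : ∀ i, z i ∈ maximalIdeal R)
    (hstab : ∀ (g : I) (i : Fin r), τ g (z i) ∈ Ideal.span {z i} ⊔ maximalIdeal R ^ 2)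
    (hspan : maximalIdeal R ≤ Ideal.span (Set.range z) ⊔ maximalIdeal R ^ 2) :
    HasNormalSylow p I :=
  hasNormalSylow_of_boundary_flag_kernel p hτ hres z hz hstab fun M _ hM =>
    hasNormalSylow_quotient_of_forall_coprime_mem M fun g _ => (hM g).mpr fun _ hx =>
      hspan (sub_mem (apply_mem_maximalIdeal_of_res hres g hx) hx)

/-- **Toral top action**: if the COMMUTATORS of `I` act trivially on the top piece `𝔪 / ((z) + 𝔪²)`
(`τ (g h g⁻¹ h⁻¹) x − x ∈ (z) + 𝔪²` for `x ∈ 𝔪`) — the inertia acts there through an abelian group, e.g. diagonally in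
some basis — then `I` is p-closed. The end state «the tame part acts torically modulo the stable boundary» of the
all-dimensional tame layer. [folklore] -/
theorem hasNormalSylow_of_commutator_trivial_mod_boundary (p : ℕ) [Fact p.Prime] [IsNoetherianRing R]
    [CharP (ResidueField R) p] [Finite I] {τ : I →* (R ≃+* R)} (hτ : Function.Injective τ)
    (hres : ∀ (g : I) (r : R), τ g r - r ∈ maximalIdeal R)
    {r : ℕ} (z : Fin r → R) (hz : ∀ i, z i ∈ maximalIdeal R)
    (hstab : ∀ (g : I) (i : Fin r), τ g (z i) ∈ Ideal.span {z i} ⊔ maximalIdeal R ^ 2)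
    (hcomm : ∀ g h : I, ∀ x ∈ maximalIdeal R,
      τ (g * h * g⁻¹ * h⁻¹) x - x ∈ Ideal.span (Set.range z) ⊔ maximalIdeal R ^ 2) :
    HasNormalSylow p I :=
  hasNormalSylow_of_boundary_flag_kernel p hτ hres z hz hstab fun M _ hM =>
    hasNormalSylow_quotient_of_commutator_mem M fun g h => (hM _).mpr (hcomm g h)

end LocalRing

end Summit.ResolutionOfSingularities.ResolutionOfSingularities.Theorems.WildQuotientResolution.TameEndState
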